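import Summits.QuantumFields.YangMills.Theorems.FluctuationComparisonRegPrIntLS1aInvariantVersion
import Literature.MathematicalPhysics.QuantumFieldTheory.Balaban1983to89.T3PrintedRegularOrbits
import Summits.QuantumFields.YangMills.Theorems.FluctuationComparisonRegPrIntLS1aTowerLawSandwich
import HarnessLib

/-!
# `FluctuationComparisonRegPrIntLS1aTowerLawInvariance` — S1aᴴ's RUN LAWS AND CUT-TOWER LAWS ARE GAUGE-INVARIANT MEASURES, and THE «ONE VERSION» DOOR IN S1aᴴ's
# BINDERS: from any density family of the cut tower, ONE family of versions gauge invariant AT EVERY POINT, measurable, `≥ 0`, densities of the same laws, continuous on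
# the maximal regular set and pointwise-determined there, with a.e. window sandwiches read POINTWISE (UV3-NODE §69.2 δ7∕δ11)

Cell `ym3-torus` (HUMAN RULING D-0037: rung R3 = continuum SU(2) Yang–Mills on T³ — NOT d = 4, NOT infinite volume, NOT a mass gap, NOT Clay), WIDTH COPY «width 17»
of ym3-torus-p1, seat `ym3-torus-px17` gen 20; `--kind proof --supports stmt-QuantumFields-20520 --as helper` (count-neutral).  THEOREMS ONLY (no `def`, no `sorry`,
no `instance`, no `notation`, default heartbeats).  Second file of pen (a) «ONE VERSION door» (px8 g22 «GO — YOURS» 10:29:36Z); the first, ✓`…S1aInvariantVersion`, carries the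
generic version lemmas on any `GaugeField P j SU(N)`; this one instantiates them on S1aᴴ's laws.

CONTENT.
* §2 ★`map_gaugeAct_map_descendTo` (push-forwards of fine-gauge-invariant laws along `descendTo` are invariant: every coarse gauge transformation lifts, lit
  ✓`T3PrintedRegularOrbits.descendTo_gaugeAct`∕`descTransf_liftTransfTo`), ★`map_gaugeAct_run` (S1aᴴ's run laws `ν K j = (descendTo)_* Gibbs_K` — ✓p819387
  `run_eq_map_descendTo` + lit ✓`map_gaugeAct_gibbsMeasure`), ★★`map_gaugeAct_tower` (the cut tower with ANY measurable gauge-invariant cut weights `χ i` — the line's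
  `sfCut θ_i` is a function of the plaquette variables, one instance; downward induction with ✓p819387 `map_withDensity_comp_eq` and ✓`descend_eq_descendTo'`).
* §3 ★★★`invariantVersion_spec` (explicit term `Node00.canonVersion dU_j (T3OrbitAverage.orbAvg (ρ₀ j))`) and ★★`exists_invariantVersion` (S1aᴴ's `∃ ρ : (j : ℕ) → …,
  ∀ j (hjK : j ≤ K), …` shape): (i) `GaugeField.GaugeInvariant (ρ j)` at every point; (ii) `Measurable`, `0 ≤`; (iii) `μ j = dU_j.withDensity (ofReal ∘ ρ j)`, `ρ j = ρ₀ j` a.e.;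
  (iv) `ContinuousOn (ρ j) (Node00.regSet dU_j (ρ₀ j))` and equality with every continuous representative on every open set carrying one; (v) δ7 both ways on every open
  `U ⊆ regSet` (a.e. bounds by functions continuous on `U` become pointwise).

AS PRINTED vs AS TYPED (★p1 «every gap named»).  [Balaban1985Averaging] (11)–(13) p. 19 («we demand that the averaging preserves gauge transformations, Ū^u = (Ū)^u …
T maps gauge-invariant densities to gauge-invariant ones») is the whole printed content of §2; the rest is the TYPED obligation «one pointwise version for (p)(w)(m)(c)»
(UV3-NODE §67.3) discharged up to ONE displayed residual: «`{PlaqSmall θ_j} ⊆ Node00.regSet dU_j (ρ₀ j)`» = the window continuity class of the FULL tower density (§67.3 (c);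
typed for the `histGood`-restricted densities by ✓WREG only; unprinted; NOT asserted here).  The (m2) door (UV3-NODE §69.2) reads δ11 off (i) through
✓`…gaugeInvariant_readAtLevel`, and δ7 off (v) with its own continuous bounds (the (47′)∕(41′) exponentials of ✓p820217, continuous iff `Pint ∘ Umin` and the minimal action
are — δ7's named residual, §55).

HONEST FRAMING.  Measure-theoretic bookkeeping over Mathlib and landed tree facts; nothing of Bałaban's analysis is asserted or proved; S1a(ᴴ) — (m) AS TYPED misstated by
currency (★★OWNER RULING №80; repair (R-β1′) with the substrate), AS PRINTED OPEN; (c) for the full marginal, (a), 26243, S2β, `SpreadFibreLawH(J)(sq)`, the five registered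
stubs of `Lines/semiclassical_s2beta.lean`, crux 20520 ∕ 19936 ∕ 19200 and `YM3TorusSU2` are NOT proved; no registered stub is closed; registry untouched; rung R3 = SU(2) YM₃ on
T³ at fixed lattice data — NOT d = 4, NOT infinite volume, NOT a mass gap, NOT Clay; the Yang–Mills mass gap is NOT proved by any of this.
References: [Balaban1985Averaging] CMP 98 (1985) (10)–(13) p. 19; [Balaban1985UV3] CMP 102 (1985) (2) p. 256, (7) p. 257, (41) p. 266, (47) p. 267; [Balaban1987RG1] CMP 109
(1987) (0.4)∕(0.11) p. 253, (0.13) p. 254.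
-/

set_option autoImplicit false

noncomputable section

namespace Summit.QuantumFields.YangMills.Theorems.FluctuationComparisonRegPrIntLS1aTowerLawInvariance

open MeasureTheory Filter Topology Set Function
open scoped ENNReal NNReal
open Literature.MathematicalPhysics.QuantumFieldTheory.Balaban1983to89
open Literature.MathematicalPhysics.QuantumFieldTheory.Balaban1983to89.Node00 (canonVersion regSet)
open Literature.MathematicalPhysics.QuantumFieldTheory.Balaban1983to89.T3OrbitAverage (orbAvg)
open Literature.MathematicalPhysics.QuantumFieldTheory.Balaban1983to89.B12RTGaugeInvariance254 (measurable_gaugeAct)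
open Summit.QuantumFields.YangMills.Theorems.FluctuationComparisonRegPrIntLS1aInvariantVersion

/-! ## §2 The S1aᴴ laws — runs `ν K j` and cut towers `μ j` — ARE gauge-invariant measures -/

section Laws

open T3ContinuumYM3Torus T3NestedUnitLaws T3UnitLawDensityEML T3UnitScaleTilt T3TiltDescent T4Continuum
open T3PrintedRegularOrbits (descendTo_gaugeAct descTransf liftTransfTo descTransf_liftTransfTo)
open T3UnitLawGaugeInvariance (map_gaugeAct_gibbsMeasure)
open Summit.QuantumFields.YangMills.Theorems.FluctuationComparisonRegPrIntLS1aTowerLawSandwich (run_eq_map_descendTo map_withDensity_comp_eq)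
open Summit.QuantumFields.YangMills.Theorems.FluctuationComparisonRegPrIntLOrganTangentFibredChartDescendTo (descend_eq_descendTo')

variable (F : T3Family) {γ : ℝ}

/-- **PUSH-FORWARDS ALONG THE DESCENT ARE GAUGE INVARIANT**: if a law `μ₀` on the finest lattice of run `K` is invariant under every fine gauge transformation, then
`(descendTo F ℰp j K)_* μ₀` is invariant under every gauge transformation `w` of the height-`j` lattice — `w` lifts to a fine `u` with `D(U^u) = (D U)^w`
(lit ✓`descendTo_gaugeAct`, ✓`descTransf_liftTransfTo`: [Balaban1985Averaging] (11)–(13)). [cite: Balaban1985Averaging, (11)-(13) p.19] -/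
theorem map_gaugeAct_map_descendTo {j K : ℕ} (hjK : j ≤ K) (μ₀ : Measure (GaugeField (F.P K) 0 ↥(Matrix.specialUnitaryGroup (Fin 2) ℂ)))
    (hμ₀ : ∀ u : GaugeTransf (F.P K) 0 ↥(Matrix.specialUnitaryGroup (Fin 2) ℂ), μ₀.map (GaugeField.gaugeAct u) = μ₀)
    (w : GaugeTransf (F.P j) 0 ↥(Matrix.specialUnitaryGroup (Fin 2) ℂ)) :
    (μ₀.map (descendTo F ℰp j K hjK)).map (GaugeField.gaugeAct w) = μ₀.map (descendTo F ℰp j K hjK) := by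
  have hD : Measurable (descendTo F ℰp j K hjK : GaugeField (F.P K) 0 ↥(Matrix.specialUnitaryGroup (Fin 2) ℂ) →
      GaugeField (F.P j) 0 ↥(Matrix.specialUnitaryGroup (Fin 2) ℂ)) := measurable_descendTo F ℰp measurableE_ℰp hjK
  set u := liftTransfTo F j K hjK w with hu
  have hcomm : (GaugeField.gaugeAct w) ∘ (descendTo F ℰp j K hjK) =
      (descendTo F ℰp j K hjK) ∘ (GaugeField.gaugeAct u : GaugeField (F.P K) 0 ↥(Matrix.specialUnitaryGroup (Fin 2) ℂ) → _) := by
    funext U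
    show GaugeField.gaugeAct w (descendTo F ℰp j K hjK U) = descendTo F ℰp j K hjK (GaugeField.gaugeAct u U)
    rw [descendTo_gaugeAct, hu, descTransf_liftTransfTo]
  rw [Measure.map_map (measurable_gaugeAct w) hD, hcomm, ← Measure.map_map hD (measurable_gaugeAct u), hμ₀ u]

/-- **EVERY FUNCTION OF THE PLAQUETTE DISTANCES IS GAUGE INVARIANT** (`U^u(∂p) = u(x)U(∂p)u(x)⁻¹`, `dist1` is a class function) — the cut weights of S1aᴴ's tower
(the line's `sfCut θ U = ∏_p max 0 (min 1 ((24∕25·θ − dist1 U(∂p))∕((24∕25 − 1∕2)·θ)))`) are of this form. [cite: Balaban1985Averaging, (9) and (12) p.19] -/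
theorem gaugeInvariant_of_plaqDist {P : Params} {k : ℕ} {G : Type*} [GaugeGroup G] {α : Type*} (Φ : (Plaq P k → ℝ) → α) :
    GaugeField.GaugeInvariant (fun U : GaugeField P k G => Φ (fun p => dist1 (GaugeField.plaqHol U p))) := by
  intro u U
  simp only [T4WilsonGaugeFlatDirection.plaqHol_gaugeAct, GaugeGroup.dist1_conj]

/-- The line's smooth cut TERM, lifted to `ℝ≥0∞`, is gauge invariant (the `hχinv` input of `map_gaugeAct_tower` for S1aᴴ's `sfCut`). [cite: Balaban1985Averaging, (12) p.19] -/
theorem sfCutTerm_gaugeAct {P : Params} {k : ℕ} (θ : ℝ) (u : GaugeTransf P k ↥(Matrix.specialUnitaryGroup (Fin 2) ℂ))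
    (U : GaugeField P k ↥(Matrix.specialUnitaryGroup (Fin 2) ℂ)) :
    ENNReal.ofReal (∏ p : Plaq P k, max 0 (min 1 ((24 / 25 * θ - dist1 (GaugeField.plaqHol (GaugeField.gaugeAct u U) p)) / ((24 / 25 - 1 / 2) * θ)))) =
      ENNReal.ofReal (∏ p : Plaq P k, max 0 (min 1 ((24 / 25 * θ - dist1 (GaugeField.plaqHol U p)) / ((24 / 25 - 1 / 2) * θ)))) := by
  simp only [T4WilsonGaugeFlatDirection.plaqHol_gaugeAct, GaugeGroup.dist1_conj]

/-- ★ **THE RUN LAWS ARE GAUGE INVARIANT**: under S1aᴴ's two run hypotheses (`ν K K = Gibbs_K`, `ν K j = (descend F ℰp j)_* ν K (j+1)`), every `ν K j` (`j ≤ K`, `γ ≥ 0`) is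
invariant under every gauge transformation of its lattice (✓p819387 `run_eq_map_descendTo` + lit ✓`map_gaugeAct_gibbsMeasure` + the previous lemma).
[cite: Balaban1985Averaging, (11)-(13) p.19] -/
theorem map_gaugeAct_run (hγ : 0 ≤ γ)
    (ν : ℕ → (j : ℕ) → Measure (GaugeField (F.P j) 0 ↥(Matrix.specialUnitaryGroup (Fin 2) ℂ)))
    (hν1 : ∀ K, ν K K = T4GenFunBounds.gibbsMeasure (F.P K) ((F.scheme ℰp γ).β K))
    (hν2 : ∀ K j, j < K → ν K j = Measure.map (descend F ℰp j) (ν K (j + 1)))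
    {j K : ℕ} (hjK : j ≤ K) (w : GaugeTransf (F.P j) 0 ↥(Matrix.specialUnitaryGroup (Fin 2) ℂ)) :
    (ν K j).map (GaugeField.gaugeAct w) = ν K j := by
  rw [run_eq_map_descendTo F ν hν1 hν2 hjK]
  refine map_gaugeAct_map_descendTo F hjK _ (fun u => ?_) w
  rw [gibbsK_eq]
  exact map_gaugeAct_gibbsMeasure (F.P K) (F.scheme_β_nonneg ℰp hγ K) u

/-- ★ **THE CUT-TOWER LAWS ARE GAUGE INVARIANT**: under S1aᴴ's run and cut-tower hypotheses with ANY measurable GAUGE-INVARIANT cut weights `χ i` (the line's `sfCut θ_i` is a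
function of the plaquette variables `dist1 U(∂p)`, hence one instance), every `μ j` (`j ≤ K`) is invariant under every gauge transformation of its lattice — downward induction
from the anchor: an invariant weight on an invariant law gives an invariant weighted law (✓p819387 `map_withDensity_comp_eq`), and the one-step descent pushes invariance down
(`descend = descendTo (j+1 ↦ j)`, ✓`descend_eq_descendTo'`). [cite: Balaban1985Averaging, (11)-(13) p.19] -/
theorem map_gaugeAct_tower (hγ : 0 ≤ γ)
    (χ : (i : ℕ) → GaugeField (F.P i) 0 ↥(Matrix.specialUnitaryGroup (Fin 2) ℂ) → ℝ≥0∞) (hχm : ∀ i, Measurable (χ i))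
    (hχinv : ∀ i (u : GaugeTransf (F.P i) 0 ↥(Matrix.specialUnitaryGroup (Fin 2) ℂ)) U, χ i (GaugeField.gaugeAct u U) = χ i U)
    (ν : ℕ → (j : ℕ) → Measure (GaugeField (F.P j) 0 ↥(Matrix.specialUnitaryGroup (Fin 2) ℂ)))
    (hν1 : ∀ K, ν K K = T4GenFunBounds.gibbsMeasure (F.P K) ((F.scheme ℰp γ).β K))
    (hν2 : ∀ K j, j < K → ν K j = Measure.map (descend F ℰp j) (ν K (j + 1)))
    {K Ts : ℕ} (hTs : Ts ≤ K)
    (μ : (j : ℕ) → Measure (GaugeField (F.P j) 0 ↥(Matrix.specialUnitaryGroup (Fin 2) ℂ)))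
    (hanch : ∀ j, Ts ≤ j → μ j = ν K j)
    (hcut : ∀ j, j < Ts → μ j = Measure.map (descend F ℰp j) ((μ (j + 1)).withDensity (χ (j + 1))))
    {j : ℕ} (hjK : j ≤ K) (w : GaugeTransf (F.P j) 0 ↥(Matrix.specialUnitaryGroup (Fin 2) ℂ)) :
    (μ j).map (GaugeField.gaugeAct w) = μ j := by
  -- downward induction on the depth `d = K − j`
  suffices h : ∀ (d j : ℕ), j ≤ K → j + d = K → ∀ w : GaugeTransf (F.P j) 0 ↥(Matrix.specialUnitaryGroup (Fin 2) ℂ),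
      (μ j).map (GaugeField.gaugeAct w) = μ j from h (K - j) j hjK (by omega) w
  intro d
  induction d with
  | zero =>
    intro j hjK hj w
    rw [hanch j (by omega)]
    exact map_gaugeAct_run F hγ ν hν1 hν2 hjK w
  | succ d ih =>
    intro j hjK hj w
    by_cases hTj : Ts ≤ j
    · rw [hanch j hTj]
      exact map_gaugeAct_run F hγ ν hν1 hν2 hjK w
    · have hjT : j < Ts := lt_of_not_ge hTj
      have hjK' : j + 1 ≤ K := by omega
      have ih' := ih (j + 1) hjK' (by omega)
      rw [hcut j hjT]
      -- the weighted law at height `j + 1` is invariant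
      have hwd : ∀ u : GaugeTransf (F.P (j + 1)) 0 ↥(Matrix.specialUnitaryGroup (Fin 2) ℂ),
          ((μ (j + 1)).withDensity (χ (j + 1))).map (GaugeField.gaugeAct u) = (μ (j + 1)).withDensity (χ (j + 1)) := by
        intro u
        have e : (χ (j + 1)) = fun U => χ (j + 1) (GaugeField.gaugeAct u U) := funext fun U => (hχinv (j + 1) u U).symm
        conv_lhs => rw [e]
        rw [map_withDensity_comp_eq (measurable_gaugeAct u) (hχm (j + 1)), ih' u]
      -- push it down one step: `descend F ℰp j = descendTo F ℰp j (j+1)`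
      have hd : Measurable (descend F ℰp j : GaugeField (F.P (j + 1)) 0 ↥(Matrix.specialUnitaryGroup (Fin 2) ℂ) →
          GaugeField (F.P j) 0 ↥(Matrix.specialUnitaryGroup (Fin 2) ℂ)) := measurable_descend F ℰp measurableE_ℰp j
      have e1 : (descend F ℰp j : GaugeField (F.P (j + 1)) 0 ↥(Matrix.specialUnitaryGroup (Fin 2) ℂ) →
          GaugeField (F.P j) 0 ↥(Matrix.specialUnitaryGroup (Fin 2) ℂ)) = descendTo F ℰp j (j + 1) (Nat.le_succ j) :=
        funext fun U => descend_eq_descendTo' F j (Nat.le_succ j) U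
      rw [e1]
      exact map_gaugeAct_map_descendTo F (Nat.le_succ j) _ hwd w

end Laws

/-! ## §3 The door in S1aᴴ's binders: ONE gauge-invariant measurable version per height, with (w) kept and (c)∕(p)∕δ7 read on it -/

section Door

open T3ContinuumYM3Torus T3NestedUnitLaws T3UnitLawDensityEML T3UnitScaleTilt T3TiltDescent T4Continuum

variable (F : T3Family) {γ : ℝ}

/-- ★★★ **THE «ONE VERSION» DOOR FOR S1aᴴ's `∃ ρ`.**  Fix S1aᴴ's run system `ν` and cut tower `μ` (`Lines/runpair_organ.lean` v18.4 :534, with ANY measurable gauge-invariant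
cut weights `χ i` — the line's `sfCut θ_i` is one instance) and ANY family of densities `ρ₀ j ≥ 0` of the tower laws (`μ j = dU_j.withDensity (ofReal ∘ ρ₀ j)`, e.g. ✓p819880
`exists_densities`).  Then the Γ-averaged canonical versions `ρ j := canonVersion dU_j (orbAvg (ρ₀ j))` satisfy, at every height `j ≤ K`:
(i) `GaugeField.GaugeInvariant (ρ j)` AT EVERY POINT (the `Witness.gaugeInvariant` field of the (m2) door, UV3-NODE §69.2 δ11); (ii) `Measurable (ρ j)`, `0 ≤ ρ j`;
(iii) (w) kept: `μ j = dU_j.withDensity (ofReal ∘ ρ j)` and `ρ j = ρ₀ j` a.e.; (iv) (c) read on the version: `ρ j` is continuous on the maximal regular set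
`Node00.regSet dU_j (ρ₀ j)` (version-independent; WREG's currency), and EQUALS every continuous representative on every open set carrying one; (v) δ7: on every open
`U ⊆ regSet`, a.e. lower∕upper bounds by functions continuous on `U` hold for `ρ j` AT EVERY POINT of `U` (so (p) follows from a continuous positive a.e.-minorant, e.g.
WREG's `Z⁻¹·heightDensityCan (histGood)` under ✓p819387's sandwich).  The ONE displayed residual for reading S1aᴴ's (p)(c)(m) on this version is therefore
«`{PlaqSmall θ_j} ⊆ Node00.regSet dU_j (ρ₀ j)`» — the window continuity class of the FULL tower density (UV3-NODE §67.3 (c); unprinted; not asserted here).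
[cite: Balaban1985Averaging, (10)-(13) p.19; Balaban1987RG1, (0.13) p.254] -/
theorem invariantVersion_spec (hγ : 0 ≤ γ)
    (χ : (i : ℕ) → GaugeField (F.P i) 0 ↥(Matrix.specialUnitaryGroup (Fin 2) ℂ) → ℝ≥0∞) (hχm : ∀ i, Measurable (χ i))
    (hχinv : ∀ i (u : GaugeTransf (F.P i) 0 ↥(Matrix.specialUnitaryGroup (Fin 2) ℂ)) U, χ i (GaugeField.gaugeAct u U) = χ i U)
    (ν : ℕ → (j : ℕ) → Measure (GaugeField (F.P j) 0 ↥(Matrix.specialUnitaryGroup (Fin 2) ℂ)))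
    (hν1 : ∀ K, ν K K = T4GenFunBounds.gibbsMeasure (F.P K) ((F.scheme ℰp γ).β K))
    (hν2 : ∀ K j, j < K → ν K j = Measure.map (descend F ℰp j) (ν K (j + 1)))
    {K Ts : ℕ} (hTs : Ts ≤ K)
    (μ : (j : ℕ) → Measure (GaugeField (F.P j) 0 ↥(Matrix.specialUnitaryGroup (Fin 2) ℂ)))
    (hanch : ∀ j, Ts ≤ j → μ j = ν K j)
    (hcut : ∀ j, j < Ts → μ j = Measure.map (descend F ℰp j) ((μ (j + 1)).withDensity (χ (j + 1))))
    (ρ₀ : (j : ℕ) → GaugeField (F.P j) 0 ↥(Matrix.specialUnitaryGroup (Fin 2) ℂ) → ℝ) (hρ₀m : ∀ j, Measurable (ρ₀ j)) (hρ₀0 : ∀ j V, 0 ≤ ρ₀ j V)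
    (hρ₀w : ∀ j, j ≤ K → μ j = (fieldMeasure (F.P j) 0 ↥(Matrix.specialUnitaryGroup (Fin 2) ℂ)).withDensity (fun V => ENNReal.ofReal (ρ₀ j V)))
    {j : ℕ} (hjK : j ≤ K) :
    GaugeField.GaugeInvariant (canonVersion (fieldMeasure (F.P j) 0 ↥(Matrix.specialUnitaryGroup (Fin 2) ℂ)) (orbAvg (ρ₀ j))) ∧
    Measurable (canonVersion (fieldMeasure (F.P j) 0 ↥(Matrix.specialUnitaryGroup (Fin 2) ℂ)) (orbAvg (ρ₀ j))) ∧
    (∀ V, 0 ≤ canonVersion (fieldMeasure (F.P j) 0 ↥(Matrix.specialUnitaryGroup (Fin 2) ℂ)) (orbAvg (ρ₀ j)) V) ∧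
    μ j = (fieldMeasure (F.P j) 0 ↥(Matrix.specialUnitaryGroup (Fin 2) ℂ)).withDensity
      (fun V => ENNReal.ofReal (canonVersion (fieldMeasure (F.P j) 0 ↥(Matrix.specialUnitaryGroup (Fin 2) ℂ)) (orbAvg (ρ₀ j)) V)) ∧
    (canonVersion (fieldMeasure (F.P j) 0 ↥(Matrix.specialUnitaryGroup (Fin 2) ℂ)) (orbAvg (ρ₀ j))
      =ᵐ[fieldMeasure (F.P j) 0 ↥(Matrix.specialUnitaryGroup (Fin 2) ℂ)] ρ₀ j) ∧
    ContinuousOn (canonVersion (fieldMeasure (F.P j) 0 ↥(Matrix.specialUnitaryGroup (Fin 2) ℂ)) (orbAvg (ρ₀ j)))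
      (regSet (fieldMeasure (F.P j) 0 ↥(Matrix.specialUnitaryGroup (Fin 2) ℂ)) (ρ₀ j)) ∧
    (∀ (U : Set (GaugeField (F.P j) 0 ↥(Matrix.specialUnitaryGroup (Fin 2) ℂ))), IsOpen U →
      ∀ g : GaugeField (F.P j) 0 ↥(Matrix.specialUnitaryGroup (Fin 2) ℂ) → ℝ, ContinuousOn g U →
        g =ᵐ[(fieldMeasure (F.P j) 0 ↥(Matrix.specialUnitaryGroup (Fin 2) ℂ)).restrict U] ρ₀ j →
        EqOn (canonVersion (fieldMeasure (F.P j) 0 ↥(Matrix.specialUnitaryGroup (Fin 2) ℂ)) (orbAvg (ρ₀ j))) g U) ∧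
    (∀ (U : Set (GaugeField (F.P j) 0 ↥(Matrix.specialUnitaryGroup (Fin 2) ℂ))), IsOpen U →
      U ⊆ regSet (fieldMeasure (F.P j) 0 ↥(Matrix.specialUnitaryGroup (Fin 2) ℂ)) (ρ₀ j) →
      (∀ f : GaugeField (F.P j) 0 ↥(Matrix.specialUnitaryGroup (Fin 2) ℂ) → ℝ, ContinuousOn f U →
        (∀ᵐ V ∂(fieldMeasure (F.P j) 0 ↥(Matrix.specialUnitaryGroup (Fin 2) ℂ)).restrict U, f V ≤ ρ₀ j V) →
        ∀ V ∈ U, f V ≤ canonVersion (fieldMeasure (F.P j) 0 ↥(Matrix.specialUnitaryGroup (Fin 2) ℂ)) (orbAvg (ρ₀ j)) V) ∧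
      (∀ g : GaugeField (F.P j) 0 ↥(Matrix.specialUnitaryGroup (Fin 2) ℂ) → ℝ, ContinuousOn g U →
        (∀ᵐ V ∂(fieldMeasure (F.P j) 0 ↥(Matrix.specialUnitaryGroup (Fin 2) ℂ)).restrict U, ρ₀ j V ≤ g V) →
        ∀ V ∈ U, canonVersion (fieldMeasure (F.P j) 0 ↥(Matrix.specialUnitaryGroup (Fin 2) ℂ)) (orbAvg (ρ₀ j)) V ≤ g V)) := by
  -- the law `μ j` is gauge invariant (§2), hence so is the a.e.-class of its density `ρ₀ j` (§1)
  have hlaw : ∀ w : GaugeTransf (F.P j) 0 ↥(Matrix.specialUnitaryGroup (Fin 2) ℂ),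
      ((fieldMeasure (F.P j) 0 ↥(Matrix.specialUnitaryGroup (Fin 2) ℂ)).withDensity (fun V => ENNReal.ofReal (ρ₀ j V))).map
          (GaugeField.gaugeAct w) =
        (fieldMeasure (F.P j) 0 ↥(Matrix.specialUnitaryGroup (Fin 2) ℂ)).withDensity (fun V => ENNReal.ofReal (ρ₀ j V)) := by
    intro w
    rw [← hρ₀w j hjK]
    exact map_gaugeAct_tower F hγ χ hχm hχinv ν hν1 hν2 hTs μ hanch hcut hjK w
  have hinv : ∀ w : GaugeTransf (F.P j) 0 ↥(Matrix.specialUnitaryGroup (Fin 2) ℂ),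
      (fun V => ρ₀ j (GaugeField.gaugeAct w V)) =ᵐ[fieldMeasure (F.P j) 0 ↥(Matrix.specialUnitaryGroup (Fin 2) ℂ)] ρ₀ j :=
    fun w => comp_gaugeAct_ae_eq_of_map_withDensity_eq (hρ₀m j) (hρ₀0 j) w (hlaw w)
  have hsm : AEStronglyMeasurable (ρ₀ j) (fieldMeasure (F.P j) 0 ↥(Matrix.specialUnitaryGroup (Fin 2) ℂ)) := (hρ₀m j).aestronglyMeasurable
  refine ⟨gaugeInvariant_canonVersion_orbAvg (ρ₀ j), measurable_canonVersion_orbAvg (hρ₀m j), canonVersion_orbAvg_nonneg (hρ₀0 j), ?_,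
    canonVersion_orbAvg_ae_eq hsm hinv, continuousOn_canonVersion_orbAvg hsm hinv,
    fun U hU g hg hae => canonVersion_orbAvg_eqOn_of_continuousOn hsm hinv hU hg hae,
    fun U hU hUreg => ⟨fun f hf hle => le_canonVersion_orbAvg_on hsm hinv hU hUreg hf hle,
      fun g hg hle => canonVersion_orbAvg_le_on hsm hinv hU hUreg hg hle⟩⟩
  rw [hρ₀w j hjK]
  exact (withDensity_canonVersion_orbAvg_eq (hρ₀m j) (hρ₀0 j) hlaw).symm

/-- ★★ **PACKAGED AS S1aᴴ's `∃ ρ : (j : ℕ) → …, ∀ j (hjK : j ≤ K), …`**: from ANY measurable non-negative density family of the cut tower (e.g. ✓p819880 `exists_densities`), ONE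
family of versions that is gauge invariant at every point, measurable, non-negative, a density of the same laws, a.e. equal to the input, continuous on the input's maximal regular set
and pointwise-determined there.  Nothing of S1aᴴ is discharged: (p) and (c) ON THE WINDOW need the window to lie in that regular set; (m) and (a) are untouched.
[cite: Balaban1985Averaging, (10)-(13) p.19; Balaban1987RG1, (0.13) p.254] -/
theorem exists_invariantVersion (hγ : 0 ≤ γ)
    (χ : (i : ℕ) → GaugeField (F.P i) 0 ↥(Matrix.specialUnitaryGroup (Fin 2) ℂ) → ℝ≥0∞) (hχm : ∀ i, Measurable (χ i))
    (hχinv : ∀ i (u : GaugeTransf (F.P i) 0 ↥(Matrix.specialUnitaryGroup (Fin 2) ℂ)) U, χ i (GaugeField.gaugeAct u U) = χ i U)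
    (ν : ℕ → (j : ℕ) → Measure (GaugeField (F.P j) 0 ↥(Matrix.specialUnitaryGroup (Fin 2) ℂ)))
    (hν1 : ∀ K, ν K K = T4GenFunBounds.gibbsMeasure (F.P K) ((F.scheme ℰp γ).β K))
    (hν2 : ∀ K j, j < K → ν K j = Measure.map (descend F ℰp j) (ν K (j + 1)))
    {K Ts : ℕ} (hTs : Ts ≤ K)
    (μ : (j : ℕ) → Measure (GaugeField (F.P j) 0 ↥(Matrix.specialUnitaryGroup (Fin 2) ℂ)))
    (hanch : ∀ j, Ts ≤ j → μ j = ν K j)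
    (hcut : ∀ j, j < Ts → μ j = Measure.map (descend F ℰp j) ((μ (j + 1)).withDensity (χ (j + 1))))
    (ρ₀ : (j : ℕ) → GaugeField (F.P j) 0 ↥(Matrix.specialUnitaryGroup (Fin 2) ℂ) → ℝ) (hρ₀m : ∀ j, Measurable (ρ₀ j)) (hρ₀0 : ∀ j V, 0 ≤ ρ₀ j V)
    (hρ₀w : ∀ j, j ≤ K → μ j = (fieldMeasure (F.P j) 0 ↥(Matrix.specialUnitaryGroup (Fin 2) ℂ)).withDensity (fun V => ENNReal.ofReal (ρ₀ j V))) :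
    ∃ ρ : (j : ℕ) → GaugeField (F.P j) 0 ↥(Matrix.specialUnitaryGroup (Fin 2) ℂ) → ℝ,
      ∀ (j : ℕ) (hjK : j ≤ K),
        GaugeField.GaugeInvariant (ρ j) ∧ Measurable (ρ j) ∧ (∀ V, 0 ≤ ρ j V) ∧
        μ j = (fieldMeasure (F.P j) 0 ↥(Matrix.specialUnitaryGroup (Fin 2) ℂ)).withDensity (fun V => ENNReal.ofReal (ρ j V)) ∧
        (ρ j =ᵐ[fieldMeasure (F.P j) 0 ↥(Matrix.specialUnitaryGroup (Fin 2) ℂ)] ρ₀ j) ∧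
        ContinuousOn (ρ j) (regSet (fieldMeasure (F.P j) 0 ↥(Matrix.specialUnitaryGroup (Fin 2) ℂ)) (ρ₀ j)) ∧
        (∀ (U : Set (GaugeField (F.P j) 0 ↥(Matrix.specialUnitaryGroup (Fin 2) ℂ))), IsOpen U →
          ∀ g : GaugeField (F.P j) 0 ↥(Matrix.specialUnitaryGroup (Fin 2) ℂ) → ℝ, ContinuousOn g U →
            g =ᵐ[(fieldMeasure (F.P j) 0 ↥(Matrix.specialUnitaryGroup (Fin 2) ℂ)).restrict U] ρ₀ j → EqOn (ρ j) g U) ∧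
        (∀ (U : Set (GaugeField (F.P j) 0 ↥(Matrix.specialUnitaryGroup (Fin 2) ℂ))), IsOpen U →
          U ⊆ regSet (fieldMeasure (F.P j) 0 ↥(Matrix.specialUnitaryGroup (Fin 2) ℂ)) (ρ₀ j) →
          (∀ f : GaugeField (F.P j) 0 ↥(Matrix.specialUnitaryGroup (Fin 2) ℂ) → ℝ, ContinuousOn f U →
            (∀ᵐ V ∂(fieldMeasure (F.P j) 0 ↥(Matrix.specialUnitaryGroup (Fin 2) ℂ)).restrict U, f V ≤ ρ₀ j V) → ∀ V ∈ U, f V ≤ ρ j V) ∧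
          (∀ g : GaugeField (F.P j) 0 ↥(Matrix.specialUnitaryGroup (Fin 2) ℂ) → ℝ, ContinuousOn g U →
            (∀ᵐ V ∂(fieldMeasure (F.P j) 0 ↥(Matrix.specialUnitaryGroup (Fin 2) ℂ)).restrict U, ρ₀ j V ≤ g V) → ∀ V ∈ U, ρ j V ≤ g V)) :=
  ⟨fun j => canonVersion (fieldMeasure (F.P j) 0 ↥(Matrix.specialUnitaryGroup (Fin 2) ℂ)) (orbAvg (ρ₀ j)),
    fun _ hjK => invariantVersion_spec F hγ χ hχm hχinv ν hν1 hν2 hTs μ hanch hcut ρ₀ hρ₀m hρ₀0 hρ₀w hjK⟩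

end Door

end Summit.QuantumFields.YangMills.Theorems.FluctuationComparisonRegPrIntLS1aTowerLawInvariance

end
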